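import Mathlib.Analysis.Normed.Group.Tannery
import Literature.MathematicalPhysics.QuantumFieldTheory.Balaban1983to89.Beta.ScalarBlockGreen
import Literature.MathematicalPhysics.QuantumFieldTheory.Balaban1983to89.Beta.GhostTable
import Literature.Probability.LatticeModels.LatticeGreenPotential
import Literature.Probability.LatticeModels.VillainSpinWaveCorollaries

/-!
# Road FP (binder row D1), leaf H2-GH: THE CONSTRAINED GHOST LEG AT ZERO BACKGROUND IS an2's SCALAR BLOCK-CONSTRAINED GREEN KERNEL `Gs`,
# AND ITS WOODBURY READING AGAINST THE FREE LEG `G₀ = latticeGreen∕2`:  `Gs = G₀ + G₀Q′ᵀW`,  `Q′G₀ + Q′G₀Q′ᵀW = 0`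
# (i.e. `Gs = G₀ − G₀Q′ᵀ(Q′G₀Q′ᵀ)⁻¹Q′G₀` in EQUATION form — no coarse inverse is constructed), at FIXED block side `N`, on `ℤ^{d+1}`, `d+1 ≥ 3`

HONEST DEPENDENCY (page 1, mandatory): continuum YM on T⁴ ⇐ BetaPertH ∧ nine spine estimates (0/9 proved); BetaPertH ⇐ (D1) ∧ (D4) ∧
CAP+tail; G-an2-4 gates asym, D1 and NE2/3/4.  HONEST FRAMING (cell contract, verbatim): «discharging `BetaPertH` makes Bałaban's UV
stability UNCONDITIONAL — a real constructive-QFT result; it is NOT the continuum limit and NOT the Clay problem.»  THIS MODULE is [folklore]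
lattice potential theory BY NAME over an2's `ScalarBlockKKT`∕`ScalarBlockGreen` (`Gs`, `Ws`, `Gs_EL`, `Gs_M`, `Gs_symm`, `decay_Gs`, `decay_wS`),
lit1's `LatticeModels` Green-function tree (`neg_latticeLaplacianZd_half_latticeGreen_sub`, `tendsto_latticeGreen_cofinite`,
`IsZdHarmonicOn.eq_zero_of_tendsto_zero`, `latticeGreen_le_latticeGreen_zero`, `latticeGreen_nonneg`, `latticeGreen_neg`) and Mathlib's Tannery
theorem; ONE [our object] data definition (`ghostRem`, the Woodbury remainder), no `def … : Prop`, nothing cited, 0 sorry.  It is the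
zero-background, fixed-`N` ALGEBRA∕IDENTIFICATION half of `LEAVES-FP.md` row «H2-GH (re-stated under R-FP-17)»; the n-UNIFORM scale-n smoothness
of the remainder is row H′2-IR (owner d1-p3), NOT here; ghost VERTICES are NOT here.  0∕4 binders of row D1; NOT D1, NOT BetaPertH, NOT
continuum, NOT Clay.

ABSOLUTE RULE (cell charter, verbatim): «No internally-minted statement may enter as a cited fact. Every hypothesis is either kernel-proved
in this package or a verbatim quotation of a PUBLISHED theorem with page reference. The manuscript(s) under audit are NOT citable for their
own disputed steps — they are the thing under adjudication; programme-internal (2001/route/tribunal) claims are never citable.»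

THE READING (owner's `N7-PROOF.v3.md` §2, «GHOST LEGS: `(D_0^*D_0 on {Q′λ = 0})⁻¹ = G₀ − G₀Q′ᵀ(Q′G₀Q′ᵀ)⁻¹Q′G₀`»).  At zero background the
standard unit-lattice Faddeev–Popov operator is `−Δ = codiff₁ ∘ dz` acting on gauge parameters `λ : ℤ^{d+1} → ℝ` constrained by zero block sums
`Q′λ = 0` (`blockSum N λ = 0`).  Its Green kernel is, BY DEFINITION OF THE KKT SYSTEM, an2's `ScalarBlockKKT.Gs`: `−Δ_x Gs(x,x′) =
Ws(quo N x, x′) + δ_{x,x′}` (`Gs_EL`, the multiplier term is `Q′ᵀW`), `Q′_x Gs(·,x′) = 0` (`Gs_M`), symmetric (`Gs_symm`), canonical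
(`eq_Gs_of_solvesS`).  Against the free leg `G₀(x − x′)`, `G₀ := latticeGreen∕2` (`−ΔG₀ = δ`, `d+1 ≥ 3`), the remainder `R := Gs − G₀` satisfies
`−Δ_x R(·,x′) = Ws(quo N ·, x′)` (block-constant) and `Q′R = −Q′G₀` (§2), and — the content of this file — the INTEGRATED Woodbury form
`R(x,x′) = Σ'_y (Q′ᵀ-column of G₀)(x,y)·Ws(y,x′)` (§4, `ghostRem_eq_tsum`), whence the coarse equation `Q′G₀(·,x′) + (Q′G₀Q′ᵀ)W(·,x′) = 0`
(`coarse_woodbury`): `W = −(Q′G₀Q′ᵀ)⁻¹Q′G₀` and `Gs = G₀ − G₀Q′ᵀ(Q′G₀Q′ᵀ)⁻¹Q′G₀` read as equations.  Proof of §4: `Gs(·,x′) − G₀(· − x′) −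
(G₀Q′ᵀW)(·,x′)` is `Δ`-harmonic on all of `ℤ^{d+1}` (termwise Laplacian under the `y`-sum, §3) and tends to `0` at infinity (exponential decay of
`Gs`, Riemann–Lebesgue decay of `G₀`, Tannery's theorem for the convolution), hence vanishes (`IsZdHarmonicOn.eq_zero_of_tendsto_zero`).

CONTENT. §1 bridge `codiff₁ (dz f) = −latticeLaplacianZd f`, free column; §2 `ghostRem` and its differential Woodbury shape, block sums,
symmetry, junction with an3's `GhostTable.gFree` on `ℤ⁴`; §3 the coarse superposition `G₀Q′ᵀW`: summability, Laplacian, decay at infinity;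
§4 **`ghostRem_eq_tsum`**, **`Gs_eq_woodbury`**, **`coarse_woodbury`**.
Unit `b2b-balaban-beta-d1-formalise-leaf-06` (gen 6), 2026-08-20; `LEAVES-FP.md` row H2-GH; CLAIM «H2-GH» (journal).
-/

namespace Summit.QuantumFields.BalabanUV.Beta.FP.ConstrainedGhost

open Filter Topology Finset
open scoped BigOperators
open Literature.Probability.LatticeModels (TorusSite Torus.proj latticeGreen latticeLaplacianZd IsZdHarmonicOn
  neg_latticeLaplacianZd_half_latticeGreen_sub tendsto_latticeGreen_cofinite latticeGreen_le_latticeGreen_zero latticeGreen_nonneg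
  latticeGreen_neg)
open Literature.MathematicalPhysics.QuantumFieldTheory.Balaban1983to89
open Literature.MathematicalPhysics.QuantumFieldTheory.Balaban1983to89.Beta
open B12Sec2to5 (l1 l1_nonneg Decay510 summable_exp_neg_l1)
open AffineAveraging (Form0 unitVec dz codiff₁ box toSite blockSum)
open AffineReproduction (IsBlockConst)
open Literature.MathematicalPhysics.QuantumFieldTheory.LatticeForm (quo)
open KKTFluctuationEnergy (tsum_blocks quo_zsmul_add_toSite summable_mul_of_bdd)
open ScalarBlockKKT (Gs Ws wS Gs_EL Gs_M decay_Gs decay_wS)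
open ScalarBlockGreen (Gs_symm GsCol GsCol_bdd_summable WsAdj isBlockConst_WsAdj)

noncomputable section

variable {d N : ℕ}

/-! ## §1 The bridge to lit1's lattice Laplacian and the free column -/

/-- [folklore] an2's `codiff₁ ∘ dz` IS `−Δ` of `LatticeModels.latticeLaplacianZd`. -/
theorem codiff₁_dz_eq_neg_latticeLaplacianZd (f : Form0 (d + 1) ℝ) (x : AffineAveraging.Site (d + 1)) :
    codiff₁ (dz f) x = -latticeLaplacianZd f x := by
  simp only [AffineAveraging.codiff₁, AffineAveraging.dz, latticeLaplacianZd, AffineAveraging.unitVec, sub_add_cancel,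
    Finset.sum_sub_distrib, Finset.sum_add_distrib, Finset.sum_const, Finset.card_univ, Fintype.card_fin, nsmul_eq_mul]
  push_cast
  ring

/-- [folklore] The free leg: `G₀ z := latticeGreen z ∕ 2` solves `−Δ_x G₀(x − x′) = δ_{x,x′}` (`d + 1 ≥ 3`). -/
theorem lapN_freeCol (hd : 2 ≤ d) (x' x : AffineAveraging.Site (d + 1)) :
    codiff₁ (dz (fun z => latticeGreen (z - x') / 2)) x = if x = x' then 1 else 0 := by
  rw [codiff₁_dz_eq_neg_latticeLaplacianZd]
  exact neg_latticeLaplacianZd_half_latticeGreen_sub (d + 1) (by omega) x' x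

/-- [folklore] The free leg is bounded: `|G₀ z| ≤ G₀ 0`. -/
theorem abs_free_le (hd : 2 ≤ d) (z : AffineAveraging.Site (d + 1)) : |latticeGreen z / 2| ≤ latticeGreen (0 : AffineAveraging.Site (d + 1)) / 2 := by
  rw [abs_of_nonneg (by linarith [latticeGreen_nonneg (d + 1) (by omega) z])]
  linarith [latticeGreen_le_latticeGreen_zero (d := d + 1) (by omega) z]

/-- [folklore] `codiff₁ ∘ dz` through a finite superposition. -/
theorem lapN_finset_sum {ι : Type*} (S : Finset ι) (g : ι → Form0 (d + 1) ℝ) (x : AffineAveraging.Site (d + 1)) :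
    codiff₁ (dz (fun p => ∑ i ∈ S, g i p)) x = ∑ i ∈ S, codiff₁ (dz (g i)) x := by
  simp only [AffineAveraging.codiff₁, AffineAveraging.dz, ← Finset.sum_sub_distrib]
  exact Finset.sum_comm

/-- [folklore] `codiff₁ ∘ dz` (a finite stencil) passes under a pointwise-summable series. -/
theorem lapN_tsum {β : Type*} (F : AffineAveraging.Site (d + 1) → β → ℝ) (hF : ∀ p, Summable (F p)) (x : AffineAveraging.Site (d + 1)) :
    codiff₁ (dz (fun p => ∑' y, F p y)) x = ∑' y, codiff₁ (dz (fun p => F p y)) x := by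
  simp only [AffineAveraging.codiff₁, AffineAveraging.dz]
  rw [Summable.tsum_finsetSum (fun κ _ => ((hF _).sub (hF _)).sub ((hF _).sub (hF _)))]
  refine Finset.sum_congr rfl fun κ _ => ?_
  have h1 := hF (x - unitVec κ + unitVec κ)
  have h2 := hF (x - unitVec κ)
  have h3 := hF (x + unitVec κ)
  have h4 := hF x
  rw [(h1.sub h2).tsum_sub (h3.sub h4), h1.tsum_sub h2, h3.tsum_sub h4]

/-! ## §2 The Woodbury remainder `R := Gs − G₀` -/

section Remainder

variable [NeZero N]

/-- [our object] **THE WOODBURY REMAINDER OF THE CONSTRAINED GHOST LEG** at zero background and block side `N`: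
`ghostRem N x x′ := Gs x x′ − latticeGreen (x − x′) ∕ 2` (`= R^g_N(x,x′)` of the owner's N7-PROOF.v3 §2, `= −(G₀Q′ᵀ(Q′G₀Q′ᵀ)⁻¹Q′G₀)(x,x′)`). -/
def ghostRem (N : ℕ) [NeZero N] (x x' : AffineAveraging.Site (d + 1)) : ℝ := Gs (N := N) x x' - latticeGreen (x - x') / 2

/-- [folklore] Unfolding. -/
theorem ghostRem_apply (x x' : AffineAveraging.Site (d + 1)) : ghostRem N x x' = Gs (N := N) x x' - latticeGreen (x - x') / 2 := rfl

/-- [folklore] `Gs = G₀ + R`. -/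
theorem Gs_eq_free_add_ghostRem (x x' : AffineAveraging.Site (d + 1)) : Gs (N := N) x x' = latticeGreen (x - x') / 2 + ghostRem N x x' := by
  rw [ghostRem_apply]; ring

/-- [folklore] **THE DIFFERENTIAL WOODBURY SHAPE**: `−Δ_x R(·,x′) = Ws(quo N ·, x′)` — the remainder is the free Laplacian's inverse image of the
BLOCK-CONSTANT multiplier field `Q′ᵀW(·,x′)` (`d + 1 ≥ 3`). -/
theorem lapN_ghostRem (hd : 2 ≤ d) (x' x : AffineAveraging.Site (d + 1)) :
    codiff₁ (dz (fun z => ghostRem N z x')) x = Ws (N := N) (quo N x) x' := by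
  have e : (fun z => ghostRem N z x') = (fun z => Gs (N := N) z x') - fun z => latticeGreen (z - x') / 2 := by
    funext z; rfl
  rw [e, AffineReproduction.dz_sub, AffineReproduction.codiff₁_sub, Pi.sub_apply, Gs_EL, lapN_freeCol hd]
  ring

/-- [folklore] The multiplier field `x ↦ Ws(quo N x, x′)` is block-constant (an2's `isBlockConst_WsAdj`). -/
theorem isBlockConst_lapN_ghostRem (hd : 2 ≤ d) (x' : AffineAveraging.Site (d + 1)) :
    IsBlockConst N (codiff₁ (dz (fun z => ghostRem N z x'))) := by
  have e : codiff₁ (dz (fun z => ghostRem N z x')) = WsAdj (N := N) x' := funext fun x => lapN_ghostRem hd x' x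
  rw [e]
  exact isBlockConst_WsAdj x'

/-- [folklore] `Q′(G₀ + R) = 0`: the remainder's block sums cancel the free leg's (`Gs_M`). -/
theorem blockSum_ghostRem (x' y : AffineAveraging.Site (d + 1)) :
    blockSum N (fun z => ghostRem N z x') y = -blockSum N (fun z => latticeGreen (z - x') / 2) y := by
  have h := Gs_M (N := N) x' y
  simp only [AffineAveraging.blockSum, ghostRem_apply, Finset.sum_sub_distrib] at h ⊢
  linarith

/-- [folklore] The remainder is symmetric (`Gs_symm`, `latticeGreen` even). -/
theorem ghostRem_symm (x x' : AffineAveraging.Site (d + 1)) : ghostRem N x x' = ghostRem N x' x := by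
  rw [ghostRem_apply, ghostRem_apply, Gs_symm, ← latticeGreen_neg (x - x'), neg_sub]

/-- [folklore] Hence `Q′` kills the constrained leg in the SOURCE variable too. -/
theorem blockSum_Gs_source (x y : AffineAveraging.Site (d + 1)) : blockSum N (fun z => Gs (N := N) x z) y = 0 := by
  have h := Gs_M (N := N) x y
  simp only [AffineAveraging.blockSum] at h ⊢
  rw [← h]
  exact Finset.sum_congr rfl fun b _ => Gs_symm _ _

end Remainder

/-- [folklore] JUNCTION WITH an3's `GhostTable` on `ℤ⁴`: the constrained ghost leg is an3's free leg `gFree` plus the Woodbury remainder. -/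
theorem Gs_eq_gFree_add_ghostRem {N : ℕ} [NeZero N] (x x' : AffineAveraging.Site 4) :
    Gs (N := N) x x' = GhostTable.gFree (x - x') + ghostRem N x x' :=
  Gs_eq_free_add_ghostRem x x'

/-! ## §3 The coarse superposition `(G₀Q′ᵀW)(x,x′) := Σ'_y blockSum N (G₀(x − ·)) y · Ws(y,x′)` -/

section Superposition

variable [NeZero N]

omit [NeZero N] in
/-- [folklore] The `Q′ᵀ`-column of the free leg is bounded: `|blockSum N (G₀(x − ·)) y| ≤ |box|·G₀(0)`. -/
theorem abs_blockSum_free_le (hd : 2 ≤ d) (x y : AffineAveraging.Site (d + 1)) :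
    |blockSum N (fun z => latticeGreen (x - z) / 2) y| ≤ (box (d + 1) N).card * (latticeGreen (0 : AffineAveraging.Site (d + 1)) / 2) := by
  simp only [AffineAveraging.blockSum]
  calc |∑ b ∈ box (d + 1) N, latticeGreen (x - ((N : ℤ) • y + toSite b)) / 2|
      ≤ ∑ b ∈ box (d + 1) N, |latticeGreen (x - ((N : ℤ) • y + toSite b)) / 2| := Finset.abs_sum_le_sum_abs _ _
    _ ≤ ∑ _b ∈ box (d + 1) N, latticeGreen (0 : AffineAveraging.Site (d + 1)) / 2 := Finset.sum_le_sum fun b _ => abs_free_le hd _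
    _ = (box (d + 1) N).card * (latticeGreen (0 : AffineAveraging.Site (d + 1)) / 2) := by rw [Finset.sum_const, nsmul_eq_mul]

/-- [folklore] The multiplier column decays on the coarse lattice: `|Ws(y,x′)| ≤ C·e^{−δ|y − quo N x′|₁}`, hence is summable in `y`. -/
theorem exists_Ws_bound : ∃ δ C : ℝ, 0 < δ ∧ 0 ≤ C ∧ ∀ (y x' : AffineAveraging.Site (d + 1)),
    |Ws (N := N) y x'| ≤ C * Real.exp (-δ * l1 (y - quo N x')) := by
  obtain ⟨δ, C, hδ, hC, h⟩ := decay_wS (N := N) (d := d)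
  exact ⟨δ, C, hδ, hC, fun y x' => h (Torus.proj N x') (y - quo N x')⟩

/-- [folklore] Summability of the multiplier column. -/
theorem summable_Ws (x' : AffineAveraging.Site (d + 1)) : Summable fun y => |Ws (N := N) y x'| := by
  obtain ⟨δ, C, hδ, hC, h⟩ := exists_Ws_bound (N := N) (d := d)
  have hs : Summable fun y : AffineAveraging.Site (d + 1) => C * Real.exp (-δ * l1 (y - quo N x')) :=
    (((summable_exp_neg_l1 hδ (d + 1)).comp_injective (sub_left_injective (b := quo N x'))).mul_left C)
  exact Summable.of_nonneg_of_le (fun y => abs_nonneg _) (fun y => h y x') hs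

/-- [folklore] Summability of `y ↦ F y · Ws(y,x′)` for bounded `F`. -/
theorem summable_bdd_mul_Ws {F : AffineAveraging.Site (d + 1) → ℝ} {B : ℝ} (hF : ∀ y, |F y| ≤ B) (x' : AffineAveraging.Site (d + 1)) :
    Summable fun y => F y * Ws (N := N) y x' := by
  refine Summable.of_norm_bounded (g := fun y => |B| * |Ws (N := N) y x'|) ((summable_Ws x').mul_left |B|) fun y => ?_
  rw [Real.norm_eq_abs, abs_mul]
  exact mul_le_mul_of_nonneg_right ((hF y).trans (le_abs_self B)) (abs_nonneg _)

/-- [folklore] **`−Δ_x (G₀Q′ᵀW)(·,x′) = Ws(quo N ·, x′)`**: the Laplacian passes under the `y`-sum (every column family is bounded × summable),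
`−Δ_x blockSum N (G₀(x − ·)) y = Σ_{b ∈ box} δ_{x, N•y+b}`, and the block regrouping `Σ'_y Σ_b f(N•y + b) = Σ'_z f z` collapses the delta. -/
theorem lapN_superposition (hd : 2 ≤ d) (x' x : AffineAveraging.Site (d + 1)) :
    codiff₁ (dz (fun p => ∑' y, blockSum N (fun z => latticeGreen (p - z) / 2) y * Ws (N := N) y x')) x = Ws (N := N) (quo N x) x' := by
  -- summability of every shifted column family
  have hsum : ∀ p : AffineAveraging.Site (d + 1), Summable fun y => blockSum N (fun z => latticeGreen (p - z) / 2) y * Ws (N := N) y x' :=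
    fun p => summable_bdd_mul_Ws (fun y => abs_blockSum_free_le hd p y) x'
  -- pass `codiff₁ ∘ dz` (a finite stencil) under the sum
  rw [lapN_tsum (fun p y => blockSum N (fun z => latticeGreen (p - z) / 2) y * Ws (N := N) y x') hsum]
  have hmul : ∀ y, codiff₁ (dz (fun p => blockSum N (fun z => latticeGreen (p - z) / 2) y * Ws (N := N) y x')) x
      = codiff₁ (dz (fun p => blockSum N (fun z => latticeGreen (p - z) / 2) y)) x * Ws (N := N) y x' := by
    intro y
    simp only [AffineAveraging.codiff₁, AffineAveraging.dz, Finset.sum_mul]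
    refine Finset.sum_congr rfl fun κ _ => ?_
    ring
  simp only [hmul]
  -- the Laplacian of the `Q′ᵀ`-column of the free leg is a block delta
  have hcol : ∀ y, codiff₁ (dz (fun p => blockSum N (fun z => latticeGreen (p - z) / 2) y)) x
      = ∑ b ∈ box (d + 1) N, (if x = (N : ℤ) • y + toSite b then (1 : ℝ) else 0) := by
    intro y
    rw [show (fun p => blockSum N (fun z => latticeGreen (p - z) / 2) y)
      = fun p => ∑ b ∈ box (d + 1) N, (fun b' p' => latticeGreen (p' - ((N : ℤ) • y + toSite b')) / 2) b p from rfl, lapN_finset_sum]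
    exact Finset.sum_congr rfl fun b _ => lapN_freeCol hd _ _
  simp only [hcol, Finset.sum_mul]
  -- block regrouping of `f z := δ_{x,z} · Ws(quo N z, x′)`
  have hf : Summable fun z : AffineAveraging.Site (d + 1) => (if x = z then (1 : ℝ) else 0) * Ws (N := N) (quo N z) x' :=
    summable_of_ne_finset_zero (s := {x}) fun z hz => by
      rw [Finset.mem_singleton] at hz
      rw [if_neg (Ne.symm hz), zero_mul]
  have hblocks := tsum_blocks (N := N) hf
  have hval : ∑' z : AffineAveraging.Site (d + 1), (if x = z then (1 : ℝ) else 0) * Ws (N := N) (quo N z) x' = Ws (N := N) (quo N x) x' := by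
    rw [tsum_eq_single x (fun z hz => by rw [if_neg (Ne.symm hz), zero_mul]), if_pos rfl, one_mul]
  rw [← hval, hblocks]
  refine tsum_congr fun y => Finset.sum_congr rfl fun b hb => ?_
  rw [quo_zsmul_add_toSite (N := N) y hb]

/-- [folklore] **`(G₀Q′ᵀW)(x,x′) → 0` as `|x| → ∞`** (Tannery: each column term tends to `0` by `tendsto_latticeGreen_cofinite`, dominated by
`|box|·G₀(0)·|Ws(y,x′)|`, summable in `y`). -/
theorem tendsto_superposition_cofinite (hd : 2 ≤ d) (x' : AffineAveraging.Site (d + 1)) :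
    Tendsto (fun p => ∑' y, blockSum N (fun z => latticeGreen (p - z) / 2) y * Ws (N := N) y x') cofinite (𝓝 0) := by
  have hG : Tendsto (fun v : AffineAveraging.Site (d + 1) => latticeGreen v / 2) cofinite (𝓝 0) := by
    simpa using (tendsto_latticeGreen_cofinite (d + 1) (by omega)).div_const 2
  have hcol : ∀ y, Tendsto (fun p => blockSum N (fun z => latticeGreen (p - z) / 2) y * Ws (N := N) y x') cofinite (𝓝 0) := by
    intro y
    have h1 : Tendsto (fun p => blockSum N (fun z => latticeGreen (p - z) / 2) y) cofinite (𝓝 0) := by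
      simp only [AffineAveraging.blockSum]
      have : Tendsto (fun p => ∑ b ∈ box (d + 1) N, latticeGreen (p - ((N : ℤ) • y + toSite b)) / 2) cofinite
          (𝓝 (∑ _b ∈ box (d + 1) N, (0 : ℝ))) :=
        tendsto_finsetSum _ fun b _ => hG.comp (Function.Injective.tendsto_cofinite (sub_left_injective))
      simpa using this
    simpa using h1.mul_const (Ws (N := N) y x')
  have h := tendsto_tsum_of_dominated_convergence (𝓕 := cofinite)
    (bound := fun y => (box (d + 1) N).card * (latticeGreen (0 : AffineAveraging.Site (d + 1)) / 2) * |Ws (N := N) y x'|)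
    ((summable_Ws x').mul_left _) hcol (Filter.Eventually.of_forall fun p y => by
      rw [Real.norm_eq_abs, abs_mul]
      exact mul_le_mul_of_nonneg_right (abs_blockSum_free_le hd p y) (abs_nonneg _))
  simpa using h

end Superposition

/-! ## §4 THE INTEGRATED WOODBURY FORM -/

section Woodbury

variable [NeZero N]

/-- [folklore] **THE WOODBURY REMAINDER IS `G₀Q′ᵀW`**: `ghostRem N x x′ = Σ'_y blockSum N (G₀(x − ·)) y · Ws(y,x′)` (`d + 1 ≥ 3`, fixed `N`).
The difference is `Δ`-harmonic on `ℤ^{d+1}` (`lapN_ghostRem`, `lapN_superposition`) and tends to `0` at infinity, hence vanishes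
(`IsZdHarmonicOn.eq_zero_of_tendsto_zero`). -/
theorem ghostRem_eq_tsum (hd : 2 ≤ d) (x x' : AffineAveraging.Site (d + 1)) :
    ghostRem N x x' = ∑' y, blockSum N (fun z => latticeGreen (x - z) / 2) y * Ws (N := N) y x' := by
  set u : Form0 (d + 1) ℝ := fun p => ghostRem N p x' - ∑' y, blockSum N (fun z => latticeGreen (p - z) / 2) y * Ws (N := N) y x'
    with hu
  have hharm : IsZdHarmonicOn u Set.univ := by
    intro p _
    have h1 := lapN_ghostRem (N := N) hd x' p
    have h2 := lapN_superposition (N := N) hd x' p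
    rw [codiff₁_dz_eq_neg_latticeLaplacianZd] at h1 h2
    have e : u = (fun p => ghostRem N p x') - fun p => ∑' y, blockSum N (fun z => latticeGreen (p - z) / 2) y * Ws (N := N) y x' := rfl
    have hlin : latticeLaplacianZd u p = latticeLaplacianZd (fun p => ghostRem N p x') p
        - latticeLaplacianZd (fun p => ∑' y, blockSum N (fun z => latticeGreen (p - z) / 2) y * Ws (N := N) y x') p := by
      rw [e]; exact Literature.Probability.LatticeModels.latticeLaplacianZd_sub _ _ p
    rw [hlin]
    linarith
  have hlim : Tendsto u cofinite (𝓝 0) := by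
    have hGs : Tendsto (fun p => Gs (N := N) p x') cofinite (𝓝 0) := by
      obtain ⟨C, -, -, hs⟩ := GsCol_bdd_summable (N := N) (d := d)
      exact (hs x').tendsto_cofinite_zero
    have hG : Tendsto (fun p : AffineAveraging.Site (d + 1) => latticeGreen (p - x') / 2) cofinite (𝓝 0) := by
      have h0 : Tendsto (fun v : AffineAveraging.Site (d + 1) => latticeGreen v / 2) cofinite (𝓝 0) := by
        simpa using (tendsto_latticeGreen_cofinite (d + 1) (by omega)).div_const 2
      exact h0.comp (Function.Injective.tendsto_cofinite (sub_left_injective))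
    have h := (hGs.sub hG).sub (tendsto_superposition_cofinite (N := N) hd x')
    simpa [hu, ghostRem_apply] using h
  have h0 := hharm.eq_zero_of_tendsto_zero (by omega) hlim x
  simp only [hu] at h0
  linarith

/-- [folklore] **`Gs = G₀ + G₀Q′ᵀW`** — the constrained ghost leg in Woodbury form against the free leg, with an2's multiplier kernel `Ws` in the
role of `−(Q′G₀Q′ᵀ)⁻¹Q′G₀`. -/
theorem Gs_eq_woodbury (hd : 2 ≤ d) (x x' : AffineAveraging.Site (d + 1)) :
    Gs (N := N) x x' = latticeGreen (x - x') / 2 + ∑' y, blockSum N (fun z => latticeGreen (x - z) / 2) y * Ws (N := N) y x' := by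
  rw [Gs_eq_free_add_ghostRem, ghostRem_eq_tsum hd]

/-- [folklore] **THE COARSE WOODBURY EQUATION `Q′G₀(·,x′) + (Q′G₀Q′ᵀ)W(·,x′) = 0`**: taking block sums of `Gs = G₀ + G₀Q′ᵀW` (`Gs_M`) —
`blockSum N (G₀(· − x′)) y₀ + Σ'_y [Σ_{b ∈ box} blockSum N (G₀(N•y₀ + b − ·)) y]·Ws(y,x′) = 0`; i.e. `W = −(Q′G₀Q′ᵀ)⁻¹Q′G₀` as an EQUATION
(no inverse of the coarse operator `Q′G₀Q′ᵀ` is constructed here). -/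
theorem coarse_woodbury (hd : 2 ≤ d) (x' y₀ : AffineAveraging.Site (d + 1)) :
    blockSum N (fun z => latticeGreen (z - x') / 2) y₀
      + ∑' y, (∑ b ∈ box (d + 1) N, blockSum N (fun z => latticeGreen ((N : ℤ) • y₀ + toSite b - z) / 2) y) * Ws (N := N) y x' = 0 := by
  have hM := Gs_M (N := N) x' y₀
  have hsum : ∀ p : AffineAveraging.Site (d + 1), Summable fun y => blockSum N (fun z => latticeGreen (p - z) / 2) y * Ws (N := N) y x' :=
    fun p => summable_bdd_mul_Ws (fun y => abs_blockSum_free_le hd p y) x'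
  simp only [AffineAveraging.blockSum] at hM ⊢
  simp only [Gs_eq_woodbury hd, Finset.sum_add_distrib] at hM
  rw [← Summable.tsum_finsetSum (fun b _ => hsum _)] at hM
  simp only [AffineAveraging.blockSum, ← Finset.sum_mul] at hM
  simpa [Finset.sum_mul] using hM

end Woodbury

end

end Summit.QuantumFields.BalabanUV.Beta.FP.ConstrainedGhost
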